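import Mathlib
import HarnessLib
import Summits.NavierStokesRegularity.NavierStokesRegularity.Theorems.PoloidalWindowDoorPoloidalWindowRigidityZShockEllipticPocket
import Summits.NavierStokesRegularity.NavierStokesRegularity.Theorems.PoloidalWindowDoorPoloidalWindowRigidityZShockThickInstants

/-!
# Crux K2 `PoloidalWindowRigidity` (stmt-NavierStokesRegularity-19708), line `z_shock` — A POCKET-FREE TIME INTERVAL FOR FREE: both open
# stubs of the thick hyperbolic column (`stub_zShockThickAut`, `stub_zShockThickMod`) may assume that ALL slices near the densely hyperbolic
# time are pocket-free, the alternative being the registered residue `stub_mixedPocketThick`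

`--supports stmt-NavierStokesRegularity-19708 --as helper` (leafhand-ns-poloidalwindowdoor-3 g16, cell decomp-ns, 2026-09-01).  Def-free;
pure case analysis + landed slice analyticity.  **No stub and no summit is closed by this file; Navier–Stokes regularity is NOT proved here
(rung 0).**

The skeleton `z_shock` (sha16 c3e8eee2) hands its deciding stub `stub_zShockThickAut` and its modulated residue `stub_zShockThickMod` ONE
densely hyperbolic slice (`hdense` at the window point `z₀`: no strictly elliptic point at the time `t₀ = z₀.1`), which is why every kernel
reduction so far (g12 `…ZShockAutReduction`, g13 `…ZShockSFReduction`) ends in a SINGLE-SLICE statement (`hGN`: kinematic, no dynamics can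
act on one slice).  Companion `…ZShockAutOfSliceLiouville` (same hand) showed that the slice may be CHANGED at the price of the registered
mixed-pocket stub.  THIS FILE records the space–time form of the same freedom: for the window point `z₀` and a product box
`B_t × B_x ⊆ W` round it, EITHER every slice `t ∈ B_t` is pocket-free (`E(t,·) ≤ 0` on all of `ℝ³`,
`E = ∂₂v₀∂₀v₂ + ∂₂v₁∂₁v₂`) — an OPEN TIME INTERVAL of globally hyperbolic(-degenerate) slices of the autonomous height-evolution, on which
the Navier–Stokes time dynamics can act — OR some time `t₁ ∈ B_t` has a strictly elliptic point, which persists for nearby times by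
continuity in `t` (joint analyticity, `…ZShockThickInstants.analyticOnNhd_time_fderiv_slice`), so that a product SUB-WINDOW none of whose
times is densely hyperbolic exists: the `hpocket` clause of `stub_mixedPocketThick` VERBATIM.

* `pocketFree_or_pocketWindow` — the dichotomy (class binders for analyticity only; any open `W` of the slab, any `z₀ ∈ W`).
* ★ `stub_zShockThickAut_of_pocketFree_of_mixedPocket` — the registered type of `stub_zShockThickAut` VERBATIM ⟸ `hAutI` ∧ `hPocket`, where
  `hAutI` is the stub with ONE EXTRA HYPOTHESIS inserted after `hdense` («`∃ δ > 0`, `ball z₀.1 δ ×ˢ ball z₀.2 δ ⊆ W` and `E(t,y) ≤ 0` for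
  all `t ∈ ball z₀.1 δ = (t₀ − δ, t₀ + δ)` and ALL `y ∈ ℝ³`») and `hPocket` is the registered type of `stub_mixedPocketThick` VERBATIM.
* ★ `stub_zShockThickMod_of_pocketFree_of_mixedPocket` — the same for the modulated residue `stub_zShockThickMod` (`hModI` ∧ `hPocket`).

PLANNER-FACING CONSEQUENCE: in a skeleton v6/v7 both thick-hyperbolic stubs can carry the pocket-free INTERVAL (strictly more hypotheses,
same residue `stub_mixedPocketThick`, composition unchanged); with `…ZShockThickInstants` (isolated (TH)-instants) almost every slice of the
interval is genuinely nonlinear, and with `…ZShockAutOfSliceLiouville` the Aut column is alternatively the class-free single-slice `hGN`.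
The interval form is the natural entrance for a DYNAMICAL lever (g13's (SF) passive-scalar structure, K2-p2's variance law) next to the
kinematic one.  HONEST LABEL: bookkeeping in the kernel; closes no stub. [folklore]
-/

namespace Summit.NavierStokesRegularity.NavierStokesRegularity.Theorems.PoloidalWindowDoorPoloidalWindowRigidityZShockPocketFreeInterval

-- the problem directory repeats the summit name (`NavierStokesRegularity/NavierStokesRegularity`)
set_option linter.dupNamespace false

open Set Filter Topology Function Metric
open scoped RealInnerProductSpace InnerProductSpace
open Literature.Analysis Literature.Analysis.FluidPDE
open Summit.NavierStokesRegularity.NavierStokesRegularity.Theorems.LocalSineTubeDoorProfileAlignedWindowRigidityAncient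
open Summit.NavierStokesRegularity.NavierStokesRegularity.Theorems.PoloidalWindowDoorPoloidalWindowRigidityZShockEllipticPocket
open Summit.NavierStokesRegularity.NavierStokesRegularity.Theorems.PoloidalWindowDoorPoloidalWindowRigidityZShockThickInstants

/-- **Pocket-free interval or pocket sub-window.**  For a class profile (Type-I rate, continuity, Oseen identity — used only for joint
real-analyticity on the backward slab), an open `W` of the slab and `z₀ ∈ W`: either there is `δ > 0` with `ball z₀.1 δ ×ˢ ball z₀.2 δ ⊆ W`
such that EVERY slice `t ∈ ball z₀.1 δ` has no strictly elliptic point (`E(t,·) ≤ 0` on `ℝ³`), or there is an open nonempty `W' ⊆ W` none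
of whose times carries a densely hyperbolic slice.  Proof: a product box round `z₀`; if some `t₁` of its time ball has `E(t₁,y₁) > 0`,
continuity of `t ↦ E(t,y₁)` keeps `E(·,y₁) > 0` on a time ball round `t₁`, and `E(t,y₁) > 0` forbids density of `{E(t,·) < 0}`
(`not_dense_setOf_neg_of_pos`, slice continuity). [folklore] -/
theorem pocketFree_or_pocketWindow (C : ℝ) (v : ℝ → EuclideanSpace ℝ (Fin 3) → EuclideanSpace ℝ (Fin 3))
    (hrate : Literature.Analysis.FluidPDE.HasTypeITimeDecay C v)
    (hcont : ContinuousOn (Function.uncurry v) (Set.Iio (0 : ℝ) ×ˢ Set.univ))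
    (hmild : ∀ s t : ℝ, s < t → t < 0 → ∀ x, v t x =
      Literature.Analysis.UnboundedOperators.heatExtension (v s) (t - s) x -
        Literature.Analysis.FluidPDE.oseenDuhamel 1 s v v t x)
    {W : Set (ℝ × EuclideanSpace ℝ (Fin 3))} (hW : IsOpen W) (hWs : W ⊆ Set.Iio (0 : ℝ) ×ˢ Set.univ)
    {z₀ : ℝ × EuclideanSpace ℝ (Fin 3)} (hz₀ : z₀ ∈ W) :
    (∃ δ : ℝ, 0 < δ ∧ Metric.ball z₀.1 δ ×ˢ Metric.ball z₀.2 δ ⊆ W ∧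
        ∀ t ∈ Metric.ball z₀.1 δ, ∀ y : EuclideanSpace ℝ (Fin 3),
          fderiv ℝ (v t) y (EuclideanSpace.single 2 1) 0 * fderiv ℝ (v t) y (EuclideanSpace.single 0 1) 2 +
            fderiv ℝ (v t) y (EuclideanSpace.single 2 1) 1 * fderiv ℝ (v t) y (EuclideanSpace.single 1 1) 2 ≤ 0) ∨
    (∃ W' : Set (ℝ × EuclideanSpace ℝ (Fin 3)), W' ⊆ W ∧ IsOpen W' ∧ W'.Nonempty ∧
      ∀ z ∈ W', ¬ Dense {y : EuclideanSpace ℝ (Fin 3) |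
        fderiv ℝ (v z.1) y (EuclideanSpace.single 2 1) 0 * fderiv ℝ (v z.1) y (EuclideanSpace.single 0 1) 2 +
          fderiv ℝ (v z.1) y (EuclideanSpace.single 2 1) 1 * fderiv ℝ (v z.1) y (EuclideanSpace.single 1 1) 2 < 0}) := by
  -- a product box round `z₀` inside `W`
  obtain ⟨r, hr, hball⟩ := Metric.isOpen_iff.1 hW z₀ hz₀
  have hprod : ball z₀.1 r ×ˢ ball z₀.2 r ⊆ W := by
    rw [ball_prod_same, Prod.mk.eta]; exact hball
  by_cases hA : ∀ t ∈ Metric.ball z₀.1 r, ∀ y : EuclideanSpace ℝ (Fin 3),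
      fderiv ℝ (v t) y (EuclideanSpace.single 2 1) 0 * fderiv ℝ (v t) y (EuclideanSpace.single 0 1) 2 +
        fderiv ℝ (v t) y (EuclideanSpace.single 2 1) 1 * fderiv ℝ (v t) y (EuclideanSpace.single 1 1) 2 ≤ 0
  · exact Or.inl ⟨r, hr, hprod, hA⟩
  · right
    push Not at hA
    obtain ⟨t₁, ht₁, y₁, hy₁⟩ := hA
    -- every time of the box is a slab time
    have hneg : ∀ t ∈ ball z₀.1 r, t < 0 := fun t ht =>
      (Set.mem_prod.1 (hWs (hprod (Set.mk_mem_prod ht (mem_ball_self hr))))).1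
    -- joint analyticity ⇒ `t ↦ E(t, y₁)` is continuous at `t₁`
    have hF : AnalyticOnNhd ℝ (Function.uncurry v) (Set.Iio (0 : ℝ) ×ˢ Set.univ) :=
      Literature.Analysis.NavierStokesZoomKit.LocalSineTubeDoorProfileAlignedWindowRigidityAncient.analyticOnNhd_uncurry hcont
        (Literature.Analysis.NavierStokesZoomKit.LocalSineTubeDoorProfileAlignedWindowRigidityAncient.bdd_of_hasTypeITimeDecay hrate)
        hmild
    have hEt : ContinuousAt (fun t : ℝ =>
        fderiv ℝ (v t) y₁ (EuclideanSpace.single 2 1) 0 * fderiv ℝ (v t) y₁ (EuclideanSpace.single 0 1) 2 +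
          fderiv ℝ (v t) y₁ (EuclideanSpace.single 2 1) 1 * fderiv ℝ (v t) y₁ (EuclideanSpace.single 1 1) 2) t₁ := by
      have a1 := analyticOnNhd_time_fderiv_slice hF y₁ (EuclideanSpace.single 2 1) 0 t₁ (hneg t₁ ht₁)
      have a2 := analyticOnNhd_time_fderiv_slice hF y₁ (EuclideanSpace.single 0 1) 2 t₁ (hneg t₁ ht₁)
      have a3 := analyticOnNhd_time_fderiv_slice hF y₁ (EuclideanSpace.single 2 1) 1 t₁ (hneg t₁ ht₁)
      have a4 := analyticOnNhd_time_fderiv_slice hF y₁ (EuclideanSpace.single 1 1) 2 t₁ (hneg t₁ ht₁)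
      exact ((a1.mul a2).add (a3.mul a4)).continuousAt
    -- the strictly elliptic point persists on a time ball round `t₁` inside the box
    have hev : ∀ᶠ t in 𝓝 t₁, (0 : ℝ) <
        fderiv ℝ (v t) y₁ (EuclideanSpace.single 2 1) 0 * fderiv ℝ (v t) y₁ (EuclideanSpace.single 0 1) 2 +
          fderiv ℝ (v t) y₁ (EuclideanSpace.single 2 1) 1 * fderiv ℝ (v t) y₁ (EuclideanSpace.single 1 1) 2 ∧
        t ∈ ball z₀.1 r :=
      (continuousAt_const.eventually_lt hEt hy₁).and (isOpen_ball.mem_nhds ht₁)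
    obtain ⟨ε, hε, hεP⟩ := Metric.eventually_nhds_iff.1 hev
    refine ⟨ball t₁ ε ×ˢ ball z₀.2 r, ?_, isOpen_ball.prod isOpen_ball,
      ⟨(t₁, z₀.2), Set.mk_mem_prod (mem_ball_self hε) (mem_ball_self hr)⟩, ?_⟩
    · intro z hz
      obtain ⟨hs, hy⟩ := Set.mem_prod.1 hz
      exact hprod (Set.mk_mem_prod (hεP hs).2 hy)
    · intro z hz
      obtain ⟨hs, -⟩ := Set.mem_prod.1 hz
      obtain ⟨hpos, hsr⟩ := hεP hs
      exact not_dense_setOf_neg_of_pos (analyticOnNhd_hypDiscriminant_slice hrate hcont hmild (hneg z.1 hsr)).continuous hpos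

/-- ★ **`stub_zShockThickAut` (skeleton `z_shock`, sha16 c3e8eee2) VERBATIM from the same stub WITH A POCKET-FREE TIME INTERVAL round the
densely hyperbolic time (`hAutI`: one extra hypothesis after `hdense`) and the registered residue `stub_mixedPocketThick` (`hPocket`,
VERBATIM).**  Pure case analysis on `pocketFree_or_pocketWindow` at the stub's own `z₀`; in the pocket case all window clauses restrict to
the sub-window. [folklore] -/
theorem stub_zShockThickAut_of_pocketFree_of_mixedPocket
    (hAutI : ∀ (C : ℝ) (v : ℝ → EuclideanSpace ℝ (Fin 3) → EuclideanSpace ℝ (Fin 3)),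
        Literature.Analysis.FluidPDE.HasTypeITimeDecay C v →
        ContinuousOn (Function.uncurry v) (Set.Iio (0 : ℝ) ×ˢ Set.univ) →
        (∀ s t : ℝ, s < t → t < 0 → ∀ x, v t x =
          Literature.Analysis.UnboundedOperators.heatExtension (v s) (t - s) x -
            Literature.Analysis.FluidPDE.oseenDuhamel 1 s v v t x) →
        (∀ t < 0, Literature.Analysis.FluidPDE.VectorCalculus.IsDivFree (v t)) →
        (∀ s < 0, ∀ y, ⟪Literature.Analysis.FluidPDE.curl (v s) y, EuclideanSpace.single 2 1⟫_ℝ = 0) →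
        ∀ W : Set (ℝ × EuclideanSpace ℝ (Fin 3)), IsOpen W → W.Nonempty → W ⊆ Set.Iio (0 : ℝ) ×ˢ Set.univ →
          (∀ z ∈ W, Literature.Analysis.FluidPDE.curl (v z.1) z.2 ≠ 0 ∧
            (fderiv ℝ (v z.1) z.2 (EuclideanSpace.single 0 1) 2 ≠ 0 ∨ fderiv ℝ (v z.1) z.2 (EuclideanSpace.single 1 1) 2 ≠ 0) ∧
            (fderiv ℝ (v z.1) z.2 (EuclideanSpace.single 2 1) 0 ≠ 0 ∨ fderiv ℝ (v z.1) z.2 (EuclideanSpace.single 2 1) 1 ≠ 0)) →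
          (∀ m : ℝ → ℝ, ∀ W₁ : Set (ℝ × EuclideanSpace ℝ (Fin 3)), W₁ ⊆ W → IsOpen W₁ → W₁.Nonempty →
            ∃ z ∈ W₁, ∃ b : Fin 3, b ≠ 2 ∧
              fderiv ℝ (v z.1) z.2 (EuclideanSpace.single 2 1) b ≠
                m z.1 * fderiv ℝ (v z.1) z.2 (EuclideanSpace.single b 1) 2) →
          (∀ z ∈ W,
            fderiv ℝ (fun x => fderiv ℝ (v z.1) x (EuclideanSpace.single 2 1) 2) z.2 (EuclideanSpace.single 0 1) *
                fderiv ℝ (v z.1) z.2 (EuclideanSpace.single 1 1) 2 -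
              fderiv ℝ (fun x => fderiv ℝ (v z.1) x (EuclideanSpace.single 2 1) 2) z.2 (EuclideanSpace.single 1 1) *
                fderiv ℝ (v z.1) z.2 (EuclideanSpace.single 0 1) 2 ≠ 0) →
          (∀ z ∈ W,
            fderiv ℝ (v z.1) z.2 (EuclideanSpace.single 2 1) 0 * fderiv ℝ (v z.1) z.2 (EuclideanSpace.single 0 1) 2 +
              fderiv ℝ (v z.1) z.2 (EuclideanSpace.single 2 1) 1 * fderiv ℝ (v z.1) z.2 (EuclideanSpace.single 1 1) 2 < 0) →
          (∀ m : ℝ → ℝ → ℝ, ∀ W₁ : Set (ℝ × EuclideanSpace ℝ (Fin 3)), W₁ ⊆ W → IsOpen W₁ → W₁.Nonempty →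
            ∃ z ∈ W₁, ∃ b : Fin 3, b ≠ 2 ∧
              fderiv ℝ (v z.1) z.2 (EuclideanSpace.single 2 1) b ≠
                m z.1 (z.2 2) * fderiv ℝ (v z.1) z.2 (EuclideanSpace.single b 1) 2) →
          ∀ z₀ ∈ W, Dense {y : EuclideanSpace ℝ (Fin 3) |
              fderiv ℝ (v z₀.1) y (EuclideanSpace.single 2 1) 0 * fderiv ℝ (v z₀.1) y (EuclideanSpace.single 0 1) 2 +
                fderiv ℝ (v z₀.1) y (EuclideanSpace.single 2 1) 1 * fderiv ℝ (v z₀.1) y (EuclideanSpace.single 1 1) 2 < 0} →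
          (∃ δ : ℝ, 0 < δ ∧ Metric.ball z₀.1 δ ×ˢ Metric.ball z₀.2 δ ⊆ W ∧
            ∀ t ∈ Metric.ball z₀.1 δ, ∀ y : EuclideanSpace ℝ (Fin 3),
              fderiv ℝ (v t) y (EuclideanSpace.single 2 1) 0 * fderiv ℝ (v t) y (EuclideanSpace.single 0 1) 2 +
                fderiv ℝ (v t) y (EuclideanSpace.single 2 1) 1 * fderiv ℝ (v t) y (EuclideanSpace.single 1 1) 2 ≤ 0) →
          (∃ g : ℝ → ℝ → ℝ, ∃ W₁ : Set (ℝ × EuclideanSpace ℝ (Fin 3)), W₁ ⊆ W ∧ IsOpen W₁ ∧ z₀ ∈ W₁ ∧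
            ∀ z ∈ W₁, ∀ b : Fin 3, b ≠ 2 →
              fderiv ℝ (v z.1) z.2 (EuclideanSpace.single 2 1) b =
                g z.1 (v z.1 z.2 2) * fderiv ℝ (v z.1) z.2 (EuclideanSpace.single b 1) 2) →
          ¬ Literature.Analysis.FluidPDE.IsBackwardSingularPoint v 0)
    (hPocket : ∀ (C : ℝ) (v : ℝ → EuclideanSpace ℝ (Fin 3) → EuclideanSpace ℝ (Fin 3)),
        Literature.Analysis.FluidPDE.HasTypeITimeDecay C v →
        ContinuousOn (Function.uncurry v) (Set.Iio (0 : ℝ) ×ˢ Set.univ) →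
        (∀ s t : ℝ, s < t → t < 0 → ∀ x, v t x =
          Literature.Analysis.UnboundedOperators.heatExtension (v s) (t - s) x -
            Literature.Analysis.FluidPDE.oseenDuhamel 1 s v v t x) →
        (∀ t < 0, Literature.Analysis.FluidPDE.VectorCalculus.IsDivFree (v t)) →
        (∀ s < 0, ∀ y, ⟪Literature.Analysis.FluidPDE.curl (v s) y, EuclideanSpace.single 2 1⟫_ℝ = 0) →
        ∀ W : Set (ℝ × EuclideanSpace ℝ (Fin 3)), IsOpen W → W.Nonempty → W ⊆ Set.Iio (0 : ℝ) ×ˢ Set.univ →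
          (∀ z ∈ W, Literature.Analysis.FluidPDE.curl (v z.1) z.2 ≠ 0 ∧
            (fderiv ℝ (v z.1) z.2 (EuclideanSpace.single 0 1) 2 ≠ 0 ∨ fderiv ℝ (v z.1) z.2 (EuclideanSpace.single 1 1) 2 ≠ 0) ∧
            (fderiv ℝ (v z.1) z.2 (EuclideanSpace.single 2 1) 0 ≠ 0 ∨ fderiv ℝ (v z.1) z.2 (EuclideanSpace.single 2 1) 1 ≠ 0)) →
          (∀ m : ℝ → ℝ, ∀ W₁ : Set (ℝ × EuclideanSpace ℝ (Fin 3)), W₁ ⊆ W → IsOpen W₁ → W₁.Nonempty →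
            ∃ z ∈ W₁, ∃ b : Fin 3, b ≠ 2 ∧
              fderiv ℝ (v z.1) z.2 (EuclideanSpace.single 2 1) b ≠
                m z.1 * fderiv ℝ (v z.1) z.2 (EuclideanSpace.single b 1) 2) →
          (∀ z ∈ W,
            fderiv ℝ (fun x => fderiv ℝ (v z.1) x (EuclideanSpace.single 2 1) 2) z.2 (EuclideanSpace.single 0 1) *
                fderiv ℝ (v z.1) z.2 (EuclideanSpace.single 1 1) 2 -
              fderiv ℝ (fun x => fderiv ℝ (v z.1) x (EuclideanSpace.single 2 1) 2) z.2 (EuclideanSpace.single 1 1) *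
                fderiv ℝ (v z.1) z.2 (EuclideanSpace.single 0 1) 2 ≠ 0) →
          (∀ z ∈ W,
            fderiv ℝ (v z.1) z.2 (EuclideanSpace.single 2 1) 0 * fderiv ℝ (v z.1) z.2 (EuclideanSpace.single 0 1) 2 +
              fderiv ℝ (v z.1) z.2 (EuclideanSpace.single 2 1) 1 * fderiv ℝ (v z.1) z.2 (EuclideanSpace.single 1 1) 2 < 0) →
          (∀ m : ℝ → ℝ → ℝ, ∀ W₁ : Set (ℝ × EuclideanSpace ℝ (Fin 3)), W₁ ⊆ W → IsOpen W₁ → W₁.Nonempty →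
            ∃ z ∈ W₁, ∃ b : Fin 3, b ≠ 2 ∧
              fderiv ℝ (v z.1) z.2 (EuclideanSpace.single 2 1) b ≠
                m z.1 (z.2 2) * fderiv ℝ (v z.1) z.2 (EuclideanSpace.single b 1) 2) →
          (∀ z ∈ W, ¬ Dense {y : EuclideanSpace ℝ (Fin 3) |
              fderiv ℝ (v z.1) y (EuclideanSpace.single 2 1) 0 * fderiv ℝ (v z.1) y (EuclideanSpace.single 0 1) 2 +
                fderiv ℝ (v z.1) y (EuclideanSpace.single 2 1) 1 * fderiv ℝ (v z.1) y (EuclideanSpace.single 1 1) 2 < 0}) →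
          ¬ Literature.Analysis.FluidPDE.IsBackwardSingularPoint v 0) :
    ∀ (C : ℝ) (v : ℝ → EuclideanSpace ℝ (Fin 3) → EuclideanSpace ℝ (Fin 3)),
      Literature.Analysis.FluidPDE.HasTypeITimeDecay C v →
      ContinuousOn (Function.uncurry v) (Set.Iio (0 : ℝ) ×ˢ Set.univ) →
      (∀ s t : ℝ, s < t → t < 0 → ∀ x, v t x =
        Literature.Analysis.UnboundedOperators.heatExtension (v s) (t - s) x -
          Literature.Analysis.FluidPDE.oseenDuhamel 1 s v v t x) →
      (∀ t < 0, Literature.Analysis.FluidPDE.VectorCalculus.IsDivFree (v t)) →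
      (∀ s < 0, ∀ y, ⟪Literature.Analysis.FluidPDE.curl (v s) y, EuclideanSpace.single 2 1⟫_ℝ = 0) →
      ∀ W : Set (ℝ × EuclideanSpace ℝ (Fin 3)), IsOpen W → W.Nonempty → W ⊆ Set.Iio (0 : ℝ) ×ˢ Set.univ →
        (∀ z ∈ W, Literature.Analysis.FluidPDE.curl (v z.1) z.2 ≠ 0 ∧
          (fderiv ℝ (v z.1) z.2 (EuclideanSpace.single 0 1) 2 ≠ 0 ∨ fderiv ℝ (v z.1) z.2 (EuclideanSpace.single 1 1) 2 ≠ 0) ∧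
          (fderiv ℝ (v z.1) z.2 (EuclideanSpace.single 2 1) 0 ≠ 0 ∨ fderiv ℝ (v z.1) z.2 (EuclideanSpace.single 2 1) 1 ≠ 0)) →
        (∀ m : ℝ → ℝ, ∀ W₁ : Set (ℝ × EuclideanSpace ℝ (Fin 3)), W₁ ⊆ W → IsOpen W₁ → W₁.Nonempty →
          ∃ z ∈ W₁, ∃ b : Fin 3, b ≠ 2 ∧
            fderiv ℝ (v z.1) z.2 (EuclideanSpace.single 2 1) b ≠
              m z.1 * fderiv ℝ (v z.1) z.2 (EuclideanSpace.single b 1) 2) →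
        (∀ z ∈ W,
          fderiv ℝ (fun x => fderiv ℝ (v z.1) x (EuclideanSpace.single 2 1) 2) z.2 (EuclideanSpace.single 0 1) *
              fderiv ℝ (v z.1) z.2 (EuclideanSpace.single 1 1) 2 -
            fderiv ℝ (fun x => fderiv ℝ (v z.1) x (EuclideanSpace.single 2 1) 2) z.2 (EuclideanSpace.single 1 1) *
              fderiv ℝ (v z.1) z.2 (EuclideanSpace.single 0 1) 2 ≠ 0) →
        (∀ z ∈ W,
          fderiv ℝ (v z.1) z.2 (EuclideanSpace.single 2 1) 0 * fderiv ℝ (v z.1) z.2 (EuclideanSpace.single 0 1) 2 +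
            fderiv ℝ (v z.1) z.2 (EuclideanSpace.single 2 1) 1 * fderiv ℝ (v z.1) z.2 (EuclideanSpace.single 1 1) 2 < 0) →
        (∀ m : ℝ → ℝ → ℝ, ∀ W₁ : Set (ℝ × EuclideanSpace ℝ (Fin 3)), W₁ ⊆ W → IsOpen W₁ → W₁.Nonempty →
          ∃ z ∈ W₁, ∃ b : Fin 3, b ≠ 2 ∧
            fderiv ℝ (v z.1) z.2 (EuclideanSpace.single 2 1) b ≠
              m z.1 (z.2 2) * fderiv ℝ (v z.1) z.2 (EuclideanSpace.single b 1) 2) →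
        ∀ z₀ ∈ W, Dense {y : EuclideanSpace ℝ (Fin 3) |
            fderiv ℝ (v z₀.1) y (EuclideanSpace.single 2 1) 0 * fderiv ℝ (v z₀.1) y (EuclideanSpace.single 0 1) 2 +
              fderiv ℝ (v z₀.1) y (EuclideanSpace.single 2 1) 1 * fderiv ℝ (v z₀.1) y (EuclideanSpace.single 1 1) 2 < 0} →
        (∃ g : ℝ → ℝ → ℝ, ∃ W₁ : Set (ℝ × EuclideanSpace ℝ (Fin 3)), W₁ ⊆ W ∧ IsOpen W₁ ∧ z₀ ∈ W₁ ∧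
          ∀ z ∈ W₁, ∀ b : Fin 3, b ≠ 2 →
            fderiv ℝ (v z.1) z.2 (EuclideanSpace.single 2 1) b =
              g z.1 (v z.1 z.2 2) * fderiv ℝ (v z.1) z.2 (EuclideanSpace.single b 1) 2) →
        ¬ Literature.Analysis.FluidPDE.IsBackwardSingularPoint v 0 := by
  intro C v hrate hcont hmild hdiv hpol W hW hWne hWs hnd hpin htw hhyp hthick z₀ hz₀ hD hA
  rcases pocketFree_or_pocketWindow C v hrate hcont hmild hW hWs hz₀ with hI | ⟨W', hW'W, hW'o, hW'ne, hpk⟩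
  · exact hAutI C v hrate hcont hmild hdiv hpol W hW hWne hWs hnd hpin htw hhyp hthick z₀ hz₀ hD hI hA
  · exact hPocket C v hrate hcont hmild hdiv hpol W' hW'o hW'ne (hW'W.trans hWs) (fun z hz => hnd z (hW'W hz))
      (fun m W₂ hW₂ hW₂o hW₂ne => hpin m W₂ (hW₂.trans hW'W) hW₂o hW₂ne) (fun z hz => htw z (hW'W hz))
      (fun z hz => hhyp z (hW'W hz)) (fun m W₂ hW₂ hW₂o hW₂ne => hthick m W₂ (hW₂.trans hW'W) hW₂o hW₂ne) hpk

/-- ★ **`stub_zShockThickMod` (skeleton `z_shock`, sha16 c3e8eee2) VERBATIM from the same stub WITH A POCKET-FREE TIME INTERVAL round the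
densely hyperbolic time (`hModI`) and the registered residue `stub_mixedPocketThick` (`hPocket`, VERBATIM).** [folklore] -/
theorem stub_zShockThickMod_of_pocketFree_of_mixedPocket
    (hModI : ∀ (C : ℝ) (v : ℝ → EuclideanSpace ℝ (Fin 3) → EuclideanSpace ℝ (Fin 3)),
        Literature.Analysis.FluidPDE.HasTypeITimeDecay C v →
        ContinuousOn (Function.uncurry v) (Set.Iio (0 : ℝ) ×ˢ Set.univ) →
        (∀ s t : ℝ, s < t → t < 0 → ∀ x, v t x =
          Literature.Analysis.UnboundedOperators.heatExtension (v s) (t - s) x -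
            Literature.Analysis.FluidPDE.oseenDuhamel 1 s v v t x) →
        (∀ t < 0, Literature.Analysis.FluidPDE.VectorCalculus.IsDivFree (v t)) →
        (∀ s < 0, ∀ y, ⟪Literature.Analysis.FluidPDE.curl (v s) y, EuclideanSpace.single 2 1⟫_ℝ = 0) →
        ∀ W : Set (ℝ × EuclideanSpace ℝ (Fin 3)), IsOpen W → W.Nonempty → W ⊆ Set.Iio (0 : ℝ) ×ˢ Set.univ →
          (∀ z ∈ W, Literature.Analysis.FluidPDE.curl (v z.1) z.2 ≠ 0 ∧
            (fderiv ℝ (v z.1) z.2 (EuclideanSpace.single 0 1) 2 ≠ 0 ∨ fderiv ℝ (v z.1) z.2 (EuclideanSpace.single 1 1) 2 ≠ 0) ∧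
            (fderiv ℝ (v z.1) z.2 (EuclideanSpace.single 2 1) 0 ≠ 0 ∨ fderiv ℝ (v z.1) z.2 (EuclideanSpace.single 2 1) 1 ≠ 0)) →
          (∀ m : ℝ → ℝ, ∀ W₁ : Set (ℝ × EuclideanSpace ℝ (Fin 3)), W₁ ⊆ W → IsOpen W₁ → W₁.Nonempty →
            ∃ z ∈ W₁, ∃ b : Fin 3, b ≠ 2 ∧
              fderiv ℝ (v z.1) z.2 (EuclideanSpace.single 2 1) b ≠
                m z.1 * fderiv ℝ (v z.1) z.2 (EuclideanSpace.single b 1) 2) →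
          (∀ z ∈ W,
            fderiv ℝ (fun x => fderiv ℝ (v z.1) x (EuclideanSpace.single 2 1) 2) z.2 (EuclideanSpace.single 0 1) *
                fderiv ℝ (v z.1) z.2 (EuclideanSpace.single 1 1) 2 -
              fderiv ℝ (fun x => fderiv ℝ (v z.1) x (EuclideanSpace.single 2 1) 2) z.2 (EuclideanSpace.single 1 1) *
                fderiv ℝ (v z.1) z.2 (EuclideanSpace.single 0 1) 2 ≠ 0) →
          (∀ z ∈ W,
            fderiv ℝ (v z.1) z.2 (EuclideanSpace.single 2 1) 0 * fderiv ℝ (v z.1) z.2 (EuclideanSpace.single 0 1) 2 +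
              fderiv ℝ (v z.1) z.2 (EuclideanSpace.single 2 1) 1 * fderiv ℝ (v z.1) z.2 (EuclideanSpace.single 1 1) 2 < 0) →
          (∀ m : ℝ → ℝ → ℝ, ∀ W₁ : Set (ℝ × EuclideanSpace ℝ (Fin 3)), W₁ ⊆ W → IsOpen W₁ → W₁.Nonempty →
            ∃ z ∈ W₁, ∃ b : Fin 3, b ≠ 2 ∧
              fderiv ℝ (v z.1) z.2 (EuclideanSpace.single 2 1) b ≠
                m z.1 (z.2 2) * fderiv ℝ (v z.1) z.2 (EuclideanSpace.single b 1) 2) →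
          ∀ z₀ ∈ W, Dense {y : EuclideanSpace ℝ (Fin 3) |
              fderiv ℝ (v z₀.1) y (EuclideanSpace.single 2 1) 0 * fderiv ℝ (v z₀.1) y (EuclideanSpace.single 0 1) 2 +
                fderiv ℝ (v z₀.1) y (EuclideanSpace.single 2 1) 1 * fderiv ℝ (v z₀.1) y (EuclideanSpace.single 1 1) 2 < 0} →
          (∃ δ : ℝ, 0 < δ ∧ Metric.ball z₀.1 δ ×ˢ Metric.ball z₀.2 δ ⊆ W ∧
            ∀ t ∈ Metric.ball z₀.1 δ, ∀ y : EuclideanSpace ℝ (Fin 3),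
              fderiv ℝ (v t) y (EuclideanSpace.single 2 1) 0 * fderiv ℝ (v t) y (EuclideanSpace.single 0 1) 2 +
                fderiv ℝ (v t) y (EuclideanSpace.single 2 1) 1 * fderiv ℝ (v t) y (EuclideanSpace.single 1 1) 2 ≤ 0) →
          (∀ g : ℝ → ℝ → ℝ, ∀ W₁ : Set (ℝ × EuclideanSpace ℝ (Fin 3)), W₁ ⊆ W → IsOpen W₁ → z₀ ∈ W₁ →
            ∃ z ∈ W₁, ∃ b : Fin 3, b ≠ 2 ∧
              fderiv ℝ (v z.1) z.2 (EuclideanSpace.single 2 1) b ≠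
                g z.1 (v z.1 z.2 2) * fderiv ℝ (v z.1) z.2 (EuclideanSpace.single b 1) 2) →
          ¬ Literature.Analysis.FluidPDE.IsBackwardSingularPoint v 0)
    (hPocket : ∀ (C : ℝ) (v : ℝ → EuclideanSpace ℝ (Fin 3) → EuclideanSpace ℝ (Fin 3)),
        Literature.Analysis.FluidPDE.HasTypeITimeDecay C v →
        ContinuousOn (Function.uncurry v) (Set.Iio (0 : ℝ) ×ˢ Set.univ) →
        (∀ s t : ℝ, s < t → t < 0 → ∀ x, v t x =
          Literature.Analysis.UnboundedOperators.heatExtension (v s) (t - s) x -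
            Literature.Analysis.FluidPDE.oseenDuhamel 1 s v v t x) →
        (∀ t < 0, Literature.Analysis.FluidPDE.VectorCalculus.IsDivFree (v t)) →
        (∀ s < 0, ∀ y, ⟪Literature.Analysis.FluidPDE.curl (v s) y, EuclideanSpace.single 2 1⟫_ℝ = 0) →
        ∀ W : Set (ℝ × EuclideanSpace ℝ (Fin 3)), IsOpen W → W.Nonempty → W ⊆ Set.Iio (0 : ℝ) ×ˢ Set.univ →
          (∀ z ∈ W, Literature.Analysis.FluidPDE.curl (v z.1) z.2 ≠ 0 ∧
            (fderiv ℝ (v z.1) z.2 (EuclideanSpace.single 0 1) 2 ≠ 0 ∨ fderiv ℝ (v z.1) z.2 (EuclideanSpace.single 1 1) 2 ≠ 0) ∧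
            (fderiv ℝ (v z.1) z.2 (EuclideanSpace.single 2 1) 0 ≠ 0 ∨ fderiv ℝ (v z.1) z.2 (EuclideanSpace.single 2 1) 1 ≠ 0)) →
          (∀ m : ℝ → ℝ, ∀ W₁ : Set (ℝ × EuclideanSpace ℝ (Fin 3)), W₁ ⊆ W → IsOpen W₁ → W₁.Nonempty →
            ∃ z ∈ W₁, ∃ b : Fin 3, b ≠ 2 ∧
              fderiv ℝ (v z.1) z.2 (EuclideanSpace.single 2 1) b ≠
                m z.1 * fderiv ℝ (v z.1) z.2 (EuclideanSpace.single b 1) 2) →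
          (∀ z ∈ W,
            fderiv ℝ (fun x => fderiv ℝ (v z.1) x (EuclideanSpace.single 2 1) 2) z.2 (EuclideanSpace.single 0 1) *
                fderiv ℝ (v z.1) z.2 (EuclideanSpace.single 1 1) 2 -
              fderiv ℝ (fun x => fderiv ℝ (v z.1) x (EuclideanSpace.single 2 1) 2) z.2 (EuclideanSpace.single 1 1) *
                fderiv ℝ (v z.1) z.2 (EuclideanSpace.single 0 1) 2 ≠ 0) →
          (∀ z ∈ W,
            fderiv ℝ (v z.1) z.2 (EuclideanSpace.single 2 1) 0 * fderiv ℝ (v z.1) z.2 (EuclideanSpace.single 0 1) 2 +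
              fderiv ℝ (v z.1) z.2 (EuclideanSpace.single 2 1) 1 * fderiv ℝ (v z.1) z.2 (EuclideanSpace.single 1 1) 2 < 0) →
          (∀ m : ℝ → ℝ → ℝ, ∀ W₁ : Set (ℝ × EuclideanSpace ℝ (Fin 3)), W₁ ⊆ W → IsOpen W₁ → W₁.Nonempty →
            ∃ z ∈ W₁, ∃ b : Fin 3, b ≠ 2 ∧
              fderiv ℝ (v z.1) z.2 (EuclideanSpace.single 2 1) b ≠
                m z.1 (z.2 2) * fderiv ℝ (v z.1) z.2 (EuclideanSpace.single b 1) 2) →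
          (∀ z ∈ W, ¬ Dense {y : EuclideanSpace ℝ (Fin 3) |
              fderiv ℝ (v z.1) y (EuclideanSpace.single 2 1) 0 * fderiv ℝ (v z.1) y (EuclideanSpace.single 0 1) 2 +
                fderiv ℝ (v z.1) y (EuclideanSpace.single 2 1) 1 * fderiv ℝ (v z.1) y (EuclideanSpace.single 1 1) 2 < 0}) →
          ¬ Literature.Analysis.FluidPDE.IsBackwardSingularPoint v 0) :
    ∀ (C : ℝ) (v : ℝ → EuclideanSpace ℝ (Fin 3) → EuclideanSpace ℝ (Fin 3)),
      Literature.Analysis.FluidPDE.HasTypeITimeDecay C v →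
      ContinuousOn (Function.uncurry v) (Set.Iio (0 : ℝ) ×ˢ Set.univ) →
      (∀ s t : ℝ, s < t → t < 0 → ∀ x, v t x =
        Literature.Analysis.UnboundedOperators.heatExtension (v s) (t - s) x -
          Literature.Analysis.FluidPDE.oseenDuhamel 1 s v v t x) →
      (∀ t < 0, Literature.Analysis.FluidPDE.VectorCalculus.IsDivFree (v t)) →
      (∀ s < 0, ∀ y, ⟪Literature.Analysis.FluidPDE.curl (v s) y, EuclideanSpace.single 2 1⟫_ℝ = 0) →
      ∀ W : Set (ℝ × EuclideanSpace ℝ (Fin 3)), IsOpen W → W.Nonempty → W ⊆ Set.Iio (0 : ℝ) ×ˢ Set.univ →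
        (∀ z ∈ W, Literature.Analysis.FluidPDE.curl (v z.1) z.2 ≠ 0 ∧
          (fderiv ℝ (v z.1) z.2 (EuclideanSpace.single 0 1) 2 ≠ 0 ∨ fderiv ℝ (v z.1) z.2 (EuclideanSpace.single 1 1) 2 ≠ 0) ∧
          (fderiv ℝ (v z.1) z.2 (EuclideanSpace.single 2 1) 0 ≠ 0 ∨ fderiv ℝ (v z.1) z.2 (EuclideanSpace.single 2 1) 1 ≠ 0)) →
        (∀ m : ℝ → ℝ, ∀ W₁ : Set (ℝ × EuclideanSpace ℝ (Fin 3)), W₁ ⊆ W → IsOpen W₁ → W₁.Nonempty →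
          ∃ z ∈ W₁, ∃ b : Fin 3, b ≠ 2 ∧
            fderiv ℝ (v z.1) z.2 (EuclideanSpace.single 2 1) b ≠
              m z.1 * fderiv ℝ (v z.1) z.2 (EuclideanSpace.single b 1) 2) →
        (∀ z ∈ W,
          fderiv ℝ (fun x => fderiv ℝ (v z.1) x (EuclideanSpace.single 2 1) 2) z.2 (EuclideanSpace.single 0 1) *
              fderiv ℝ (v z.1) z.2 (EuclideanSpace.single 1 1) 2 -
            fderiv ℝ (fun x => fderiv ℝ (v z.1) x (EuclideanSpace.single 2 1) 2) z.2 (EuclideanSpace.single 1 1) *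
              fderiv ℝ (v z.1) z.2 (EuclideanSpace.single 0 1) 2 ≠ 0) →
        (∀ z ∈ W,
          fderiv ℝ (v z.1) z.2 (EuclideanSpace.single 2 1) 0 * fderiv ℝ (v z.1) z.2 (EuclideanSpace.single 0 1) 2 +
            fderiv ℝ (v z.1) z.2 (EuclideanSpace.single 2 1) 1 * fderiv ℝ (v z.1) z.2 (EuclideanSpace.single 1 1) 2 < 0) →
        (∀ m : ℝ → ℝ → ℝ, ∀ W₁ : Set (ℝ × EuclideanSpace ℝ (Fin 3)), W₁ ⊆ W → IsOpen W₁ → W₁.Nonempty →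
          ∃ z ∈ W₁, ∃ b : Fin 3, b ≠ 2 ∧
            fderiv ℝ (v z.1) z.2 (EuclideanSpace.single 2 1) b ≠
              m z.1 (z.2 2) * fderiv ℝ (v z.1) z.2 (EuclideanSpace.single b 1) 2) →
        ∀ z₀ ∈ W, Dense {y : EuclideanSpace ℝ (Fin 3) |
            fderiv ℝ (v z₀.1) y (EuclideanSpace.single 2 1) 0 * fderiv ℝ (v z₀.1) y (EuclideanSpace.single 0 1) 2 +
              fderiv ℝ (v z₀.1) y (EuclideanSpace.single 2 1) 1 * fderiv ℝ (v z₀.1) y (EuclideanSpace.single 1 1) 2 < 0} →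
        (∀ g : ℝ → ℝ → ℝ, ∀ W₁ : Set (ℝ × EuclideanSpace ℝ (Fin 3)), W₁ ⊆ W → IsOpen W₁ → z₀ ∈ W₁ →
          ∃ z ∈ W₁, ∃ b : Fin 3, b ≠ 2 ∧
            fderiv ℝ (v z.1) z.2 (EuclideanSpace.single 2 1) b ≠
              g z.1 (v z.1 z.2 2) * fderiv ℝ (v z.1) z.2 (EuclideanSpace.single b 1) 2) →
        ¬ Literature.Analysis.FluidPDE.IsBackwardSingularPoint v 0 := by
  intro C v hrate hcont hmild hdiv hpol W hW hWne hWs hnd hpin htw hhyp hthick z₀ hz₀ hD hM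
  rcases pocketFree_or_pocketWindow C v hrate hcont hmild hW hWs hz₀ with hI | ⟨W', hW'W, hW'o, hW'ne, hpk⟩
  · exact hModI C v hrate hcont hmild hdiv hpol W hW hWne hWs hnd hpin htw hhyp hthick z₀ hz₀ hD hI hM
  · exact hPocket C v hrate hcont hmild hdiv hpol W' hW'o hW'ne (hW'W.trans hWs) (fun z hz => hnd z (hW'W hz))
      (fun m W₂ hW₂ hW₂o hW₂ne => hpin m W₂ (hW₂.trans hW'W) hW₂o hW₂ne) (fun z hz => htw z (hW'W hz))
      (fun z hz => hhyp z (hW'W hz)) (fun m W₂ hW₂ hW₂o hW₂ne => hthick m W₂ (hW₂.trans hW'W) hW₂o hW₂ne) hpk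

end Summit.NavierStokesRegularity.NavierStokesRegularity.Theorems.PoloidalWindowDoorPoloidalWindowRigidityZShockPocketFreeInterval
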